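import Summits.Ventures.CertifiedArithmetic.LowPrec.Directed
import Summits.Ventures.CertifiedArithmetic.LowPrec.Representable

/-!
# Directed rounding: sign symmetry (`RU` is the mirror of `RD`, `RZ` is odd) and its table form

HONEST FRAMING (venture CertifiedArithmetic / cell `pub-lowprec`): certified error envelopes and
provably optimal rounding/accumulation schemes for low-precision formats under stated cost models;
every table by two implementations; no hardware or vendor claims.

For every format `φ` and EVERY rational `x` (no hypothesis; the tree's `toRat_roundUp_eq_neg`
needs `x ≠ 0`): `RU(-x) = -RD(x)`, `RD(-x) = -RU(x)`, `RZ(-x) = -RZ(x)` in value, hence the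
rounding errors at `-x` and `x` have the same magnitude with the two directed-away/toward modes
exchanged. TABLE FORM (THEOREMS-R1 Theorem E5, last clause: `max(RU) = max(RD)`): for operand
formats `φ₁, φ₂`, any destination `ψ`, any threshold `lo` and constant `c`, the normal-range relative
bound `lo ≤ |t| ≤ maxRat ψ → |fl(t) - t| ≤ c · |t|` holds for ALL sums (resp. products) under
`roundUp` iff it holds for all of them under `roundDown`, and it is ATTAINED with equality under
`roundUp` iff it is under `roundDown` — because the operand sets are closed under `flipSign` and
`-(a + b) = (-a) + (-b)`, `-(a·b) = (-a)·b`. Consequently the `RU` column of every envelope table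
of the cell equals its `RD` column (ENVELOPES.md; paper Table 2 prints one `RU = RD` column), and
each kernel row `…_relRU_normal` of `EnvelopesDirected*` is the image of the `…_relRD_normal` row
under these equivalences. [cite: Higham2002ASNA, §2.1] (directed rounding modes; the symmetry is
folklore, IEEE 754 §4.3.2).
-/

namespace Literature.ComputerArithmetic.FloatingPoint

namespace Format

variable {φ : Format}

/-- The down-grid of `0` is `0`. [folklore] -/
theorem rdGrid_zero : φ.rdGrid 0 = 0 := by
  have h : ((φ.rdGrid 0 : ℕ) : ℚ) ≤ 0 := Format.rdGrid_le le_rfl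
  exact_mod_cast le_antisymm h (Nat.cast_nonneg _)

/-- The up-grid of `0` is `0` (`0` is representable). [folklore] -/
theorem ruGrid_zero : φ.ruGrid 0 = 0 := by
  have h0 : φ.Representable 0 := MiniFloat.representable_of_lt_pow (by positivity) (Nat.zero_le _)
  have := Format.ruGrid_le_of_le (φ := φ) (r := 0) le_rfl (Nat.cast_nonneg _) h0 (by simp)
  exact Nat.le_zero.mp this

end Format

namespace MiniFloat

variable {φ : Format}

/-- `RD(0) = 0` in value. [folklore] -/
theorem toRat_roundDown_zero : (roundDown φ 0).toRat = 0 := by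
  rw [toRat_roundDown, if_neg (lt_irrefl 0), abs_zero, zero_div, Format.rdGrid_zero]; simp

/-- `RU(0) = 0` in value. [folklore] -/
theorem toRat_roundUp_zero : (roundUp φ 0).toRat = 0 := by
  rw [toRat_roundUp, if_neg (lt_irrefl 0), abs_zero, zero_div, Format.ruGrid_zero]; simp

/-- `RZ(0) = 0` in value. [folklore] -/
theorem toRat_roundTowardZero_zero : (roundTowardZero φ 0).toRat = 0 := by
  rw [toRat_roundTowardZero, if_neg (lt_irrefl 0), abs_zero, zero_div, Format.rdGrid_zero]; simp

/-- MIRROR, unconditional: `RU(-x) = -RD(x)` for every `x`. [cite: IEEE7542019, §4.3.2] -/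
theorem toRat_roundUp_neg (x : ℚ) : (roundUp φ (-x)).toRat = -(roundDown φ x).toRat := by
  by_cases hx : x = 0
  · subst hx; rw [neg_zero, toRat_roundUp_zero, toRat_roundDown_zero, neg_zero]
  · rw [toRat_roundUp_eq_neg (neg_ne_zero.mpr hx), neg_neg]

/-- MIRROR, unconditional: `RD(-x) = -RU(x)` for every `x`. [cite: IEEE7542019, §4.3.2] -/
theorem toRat_roundDown_neg (x : ℚ) : (roundDown φ (-x)).toRat = -(roundUp φ x).toRat := by
  have h := toRat_roundUp_neg (φ := φ) (-x)
  rw [neg_neg] at h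
  rw [h, neg_neg]

/-- `RZ` is odd: `RZ(-x) = -RZ(x)` for every `x`. [cite: IEEE7542019, §4.3.2] -/
theorem toRat_roundTowardZero_neg (x : ℚ) :
    (roundTowardZero φ (-x)).toRat = -(roundTowardZero φ x).toRat := by
  rw [toRat_roundTowardZero, toRat_roundTowardZero, abs_neg]
  rcases lt_trichotomy x 0 with h | h | h
  · rw [if_neg (by linarith), if_pos h]; ring
  · subst h; simp [Format.rdGrid_zero]
  · rw [if_pos (by linarith), if_neg (by linarith)]; ring

/-- Error mirror: the `RU` error at `-x` is the `RD` error at `x` in magnitude. [folklore] -/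
theorem abs_roundUp_neg_sub (x : ℚ) :
    |(roundUp φ (-x)).toRat - (-x)| = |(roundDown φ x).toRat - x| := by
  rw [toRat_roundUp_neg, neg_sub_neg, abs_sub_comm]

/-- Error mirror: the `RD` error at `-x` is the `RU` error at `x` in magnitude. [folklore] -/
theorem abs_roundDown_neg_sub (x : ℚ) :
    |(roundDown φ (-x)).toRat - (-x)| = |(roundUp φ x).toRat - x| := by
  rw [toRat_roundDown_neg, neg_sub_neg, abs_sub_comm]

/-- `RZ` error is even in `x`. [folklore] -/
theorem abs_roundTowardZero_neg_sub (x : ℚ) :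
    |(roundTowardZero φ (-x)).toRat - (-x)| = |(roundTowardZero φ x).toRat - x| := by
  rw [toRat_roundTowardZero_neg, neg_sub_neg, abs_sub_comm]

variable {φ₁ φ₂ : Format}

/-- TABLE MIRROR, sums, bound form: a normal-range relative bound with threshold `lo` and constant
`c` holds for every sum `a + b` (`a ∈ F_φ₁`, `b ∈ F_φ₂`) rounded UP into `ψ` iff it holds for every
sum rounded DOWN — operand sets are closed under `flipSign` and `(-a) + (-b) = -(a + b)`.
(Theorem E5, `max RU = max RD`, sums.) [cite: Higham2002ASNA, §2.1] -/
theorem relBound_roundUp_add_iff_roundDown (ψ : Format) (lo c : ℚ) :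
    (∀ (a : MiniFloat φ₁) (b : MiniFloat φ₂), lo ≤ |a.toRat + b.toRat| →
        |a.toRat + b.toRat| ≤ ψ.maxRat →
          |(roundUp ψ (a.toRat + b.toRat)).toRat - (a.toRat + b.toRat)|
            ≤ c * |a.toRat + b.toRat|) ↔
      (∀ (a : MiniFloat φ₁) (b : MiniFloat φ₂), lo ≤ |a.toRat + b.toRat| →
        |a.toRat + b.toRat| ≤ ψ.maxRat →
          |(roundDown ψ (a.toRat + b.toRat)).toRat - (a.toRat + b.toRat)|
            ≤ c * |a.toRat + b.toRat|) := by
  constructor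
  · intro h a b hlo hhi
    have key := h a.flipSign b.flipSign
    simp only [toRat_flipSign] at key
    rw [show -a.toRat + -b.toRat = -(a.toRat + b.toRat) by ring, abs_neg,
      abs_roundUp_neg_sub] at key
    exact key hlo hhi
  · intro h a b hlo hhi
    have key := h a.flipSign b.flipSign
    simp only [toRat_flipSign] at key
    rw [show -a.toRat + -b.toRat = -(a.toRat + b.toRat) by ring, abs_neg,
      abs_roundDown_neg_sub] at key
    exact key hlo hhi

/-- TABLE MIRROR, sums, attainment form: the bound `c` is attained with equality on the normal
range by some sum rounded UP iff it is by some sum rounded DOWN (the maximiser is the negated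
pair). [cite: Higham2002ASNA, §2.1] -/
theorem relAttained_roundUp_add_iff_roundDown (ψ : Format) (lo c : ℚ) :
    (∃ (a : MiniFloat φ₁) (b : MiniFloat φ₂), lo ≤ |a.toRat + b.toRat| ∧
        |a.toRat + b.toRat| ≤ ψ.maxRat ∧
          |(roundUp ψ (a.toRat + b.toRat)).toRat - (a.toRat + b.toRat)|
            = c * |a.toRat + b.toRat|) ↔
      (∃ (a : MiniFloat φ₁) (b : MiniFloat φ₂), lo ≤ |a.toRat + b.toRat| ∧
        |a.toRat + b.toRat| ≤ ψ.maxRat ∧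
          |(roundDown ψ (a.toRat + b.toRat)).toRat - (a.toRat + b.toRat)|
            = c * |a.toRat + b.toRat|) := by
  constructor
  · rintro ⟨a, b, hlo, hhi, heq⟩
    refine ⟨a.flipSign, b.flipSign, ?_⟩
    simp only [toRat_flipSign]
    rw [show -a.toRat + -b.toRat = -(a.toRat + b.toRat) by ring, abs_neg,
      abs_roundDown_neg_sub]
    exact ⟨hlo, hhi, heq⟩
  · rintro ⟨a, b, hlo, hhi, heq⟩
    refine ⟨a.flipSign, b.flipSign, ?_⟩
    simp only [toRat_flipSign]
    rw [show -a.toRat + -b.toRat = -(a.toRat + b.toRat) by ring, abs_neg,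
      abs_roundUp_neg_sub]
    exact ⟨hlo, hhi, heq⟩

/-- TABLE MIRROR, products, bound form: as for sums, with the single flip `(-a) · b = -(a · b)`.
(Theorem E5, `max RU = max RD`, products.) [cite: Higham2002ASNA, §2.1] -/
theorem relBound_roundUp_mul_iff_roundDown (ψ : Format) (lo c : ℚ) :
    (∀ (a : MiniFloat φ₁) (b : MiniFloat φ₂), lo ≤ |a.toRat * b.toRat| →
        |a.toRat * b.toRat| ≤ ψ.maxRat →
          |(roundUp ψ (a.toRat * b.toRat)).toRat - (a.toRat * b.toRat)|
            ≤ c * |a.toRat * b.toRat|) ↔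
      (∀ (a : MiniFloat φ₁) (b : MiniFloat φ₂), lo ≤ |a.toRat * b.toRat| →
        |a.toRat * b.toRat| ≤ ψ.maxRat →
          |(roundDown ψ (a.toRat * b.toRat)).toRat - (a.toRat * b.toRat)|
            ≤ c * |a.toRat * b.toRat|) := by
  constructor
  · intro h a b hlo hhi
    have key := h a.flipSign b
    simp only [toRat_flipSign] at key
    rw [neg_mul, abs_neg, abs_roundUp_neg_sub] at key
    exact key hlo hhi
  · intro h a b hlo hhi
    have key := h a.flipSign b
    simp only [toRat_flipSign] at key
    rw [neg_mul, abs_neg, abs_roundDown_neg_sub] at key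
    exact key hlo hhi

/-- TABLE MIRROR, products, attainment form. [cite: Higham2002ASNA, §2.1] -/
theorem relAttained_roundUp_mul_iff_roundDown (ψ : Format) (lo c : ℚ) :
    (∃ (a : MiniFloat φ₁) (b : MiniFloat φ₂), lo ≤ |a.toRat * b.toRat| ∧
        |a.toRat * b.toRat| ≤ ψ.maxRat ∧
          |(roundUp ψ (a.toRat * b.toRat)).toRat - (a.toRat * b.toRat)|
            = c * |a.toRat * b.toRat|) ↔
      (∃ (a : MiniFloat φ₁) (b : MiniFloat φ₂), lo ≤ |a.toRat * b.toRat| ∧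
        |a.toRat * b.toRat| ≤ ψ.maxRat ∧
          |(roundDown ψ (a.toRat * b.toRat)).toRat - (a.toRat * b.toRat)|
            = c * |a.toRat * b.toRat|) := by
  constructor
  · rintro ⟨a, b, hlo, hhi, heq⟩
    refine ⟨a.flipSign, b, ?_⟩
    simp only [toRat_flipSign]
    rw [neg_mul, abs_neg, abs_roundDown_neg_sub]
    exact ⟨hlo, hhi, heq⟩
  · rintro ⟨a, b, hlo, hhi, heq⟩
    refine ⟨a.flipSign, b, ?_⟩
    simp only [toRat_flipSign]
    rw [neg_mul, abs_neg, abs_roundUp_neg_sub]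
    exact ⟨hlo, hhi, heq⟩

end MiniFloat

end Literature.ComputerArithmetic.FloatingPoint
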